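import Summits.CriticalPhenomena.Ising3D.TaylorTableOddHeadDeltaRows
import Summits.CriticalPhenomena.Ising3D.TaylorTableOddCoeffTM
import Summits.CriticalPhenomena.Ising3D.TaylorTableEvenHeadDeltaCells
import Mathlib.Tactic.Linarith
import Mathlib.Tactic.Positivity
import Mathlib.Tactic.Ring
import HarnessLib

/-!
# The TABLE layer of a derivative certificate, XXVI: the ODD head cell checker (family head triples, parts, the affine sign test)
(cell `pub-ising3x`, seat boot-1 gen 8; gate (g2) — data and Booleans of the odd FAST head layer; the soundness theorem for a cell is the next file)

HONEST FRAMING: lottery ticket; floor = tightest certified 3D Ising CFT bounds; no exact-solution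
claim without a proof. Island framing: certified exclusion region at stated derivative order and
assumptions; not a determination of the 3D Ising critical exponents beyond that.

The odd head obligation of a cell is the sign of `Σ_{(n,j)∈F} (½)^n B(n,j)` with the bracket
`B = (−1)^ℓ cₛ κ q̂₃ + c₊ (q̂₄ − q̂₅) + (κ₀⁻¹/2)(c₋ μσ ψ̂₀ − c₊ με ψ̂_t)` (TaylorOddConeHeadQPoly); after the regularisation
`c ↦ (Δ − b_ℓ)·c` (same sign for `Δ > b_ℓ`) the three coefficient families are the Taylor models `HRTMAB.rows` of
`TaylorTableOddCoeffTM` on the three `(a, b)` boxes `(−t/2, t/2)`, `(t/2, t/2)`, `(−t/2, −t/2)`, `t = Δσ − Δε ∈ [t₁, t₂]`, and the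
five q-rows are the δ-row triples of `TaylorTableOddHeadDeltaRows`. So, on a cell `Δ = ctr + ρ`, the regularised sum is
`c₃·V₃(ρ; δ_b) + V₄(ρ; δσ) − V₅(ρ; δσ) + c₀·V₀(ρ) + c_t·V_t(ρ; δ_t)` with FIVE family head polynomials (triples in `ρ`,
`headPolyTM` order by order exactly as the even Δ-layer) and three INTERVAL scalars `c₃ = (−1)^ℓ κ`, `c₀ = μσ/(2κ₀)`,
`c_t = −με/(2κ₀)`. This file: the part structure `HeadPartOdd` (claims for the five families) and its `HeadPart` views
(so that the landed `parts_pmem` applies group by group), the per-part Boolean **`oddHeadPartOKΔ`**, the summed claims, the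
affine sign test `oddCore` / **`posOnOdd`** (recog-1's `lowB3`/`hiB3`/`lowB`/`hiB`/`mulLo`; soundness `posOnOdd_sound`), and the
final Boolean **`oddHeadFinalOKΔ`**. No new mathematics. [folklore]
-/

namespace Summit.CriticalPhenomena.Ising3D

open Finset Set
open Literature.Analysis.ValidatedNumerics Literature.Analysis.ValidatedNumerics.PolyMP
open Literature.Analysis.ValidatedNumerics.NumericsMP (MI)
open Literature.MathematicalPhysics.QuantumFieldTheory.ConformalBootstrap3D
open Literature.MathematicalPhysics.QuantumFieldTheory.ConformalBootstrap3D.HRTM (rowEntry pivOK)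

/-! ### The three coefficient Taylor-model tables of a cell -/

namespace EvenCellTM

variable (C : EvenCellTM)

/-- Models of `(Δ − b_ℓ)·cₛ` (`(a, b) = (−t/2, t/2)`, `t ∈ [t₁, t₂]`). [folklore] -/
def tmsS (S : ℕ) (t₁ t₂ : ℚ) : List (List IPoly) :=
  HRTMAB.rows S C.ctr C.ℓ C.e C.D (-t₂ / 2) (-t₁ / 2) (t₁ / 2) (t₂ / 2) C.nF
/-- Models of `(Δ − b_ℓ)·c₊` (`(a, b) = (t/2, t/2)`). [folklore] -/
def tmsP (S : ℕ) (t₁ t₂ : ℚ) : List (List IPoly) :=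
  HRTMAB.rows S C.ctr C.ℓ C.e C.D (t₁ / 2) (t₂ / 2) (t₁ / 2) (t₂ / 2) C.nF
/-- Models of `(Δ − b_ℓ)·c₋` (`(a, b) = (−t/2, −t/2)`). [folklore] -/
def tmsM (S : ℕ) (t₁ t₂ : ℚ) : List (List IPoly) :=
  HRTMAB.rows S C.ctr C.ℓ C.e C.D (-t₂ / 2) (-t₁ / 2) (-t₂ / 2) (-t₁ / 2) C.nF

end EvenCellTM

/-! ### Parts with five-family claims -/

/-- One claimed part of an odd head cell: term range and the claimed partial family head polynomials
(`P3, P4, P5, Pt` triples in the δ-orders, `P0` a single polynomial). [folklore] -/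
structure HeadPartOdd where
  /-- first term index -/
  t0 : ℕ
  /-- number of terms -/
  count : ℕ
  /-- claimed partial `V₃` triple -/
  P3 : ITriple
  /-- claimed partial `V₄` triple -/
  P4 : ITriple
  /-- claimed partial `V₅` triple -/
  P5 : ITriple
  /-- claimed partial `V₀` polynomial -/
  P0 : IPoly
  /-- claimed partial `V_t` triple -/
  Pt : ITriple

namespace HeadPartOdd

variable (p : HeadPartOdd)

/-- `HeadPart` view: family 3, the three δ-orders as the three slots. [folklore] -/
def v3 : HeadPart := ⟨p.t0, p.count, p.P3.1, p.P3.2.1, p.P3.2.2⟩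
/-- View: family 4. [folklore] -/
def v4 : HeadPart := ⟨p.t0, p.count, p.P4.1, p.P4.2.1, p.P4.2.2⟩
/-- View: family 5. [folklore] -/
def v5 : HeadPart := ⟨p.t0, p.count, p.P5.1, p.P5.2.1, p.P5.2.2⟩
/-- View: family `t`. [folklore] -/
def vt : HeadPart := ⟨p.t0, p.count, p.Pt.1, p.Pt.2.1, p.Pt.2.2⟩
/-- View: family 0 (the single polynomial in all three slots). [folklore] -/
def v0 : HeadPart := ⟨p.t0, p.count, p.P0, p.P0, p.P0⟩

end HeadPartOdd

/-- The computed partial triple of one family on a slice. [folklore] -/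
def famTriple (S : ℕ) (R0 R1 R2 : List IPoly) (tms : List (List IPoly)) (C : EvenCellTM) (sl : List (ℕ × ℕ)) : ITriple :=
  (headPolyTM S R0 tms C.nF C.ℓ C.ctr sl, headPolyTM S R1 tms C.nF C.ℓ C.ctr sl, headPolyTM S R2 tms C.nF C.ℓ C.ctr sl)

/-- **Per-part check, odd head** (one kernel declaration each): the computed partial family head polynomials on the slice are
contained in the claims (13 containments; three Taylor-model tables). [folklore] -/
def oddHeadPartOKΔ (R : OddHeadRowsΔ) (C : EvenCellTM) (t₁ t₂ : ℚ) (p : HeadPartOdd) : Bool :=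
  let sl := (C.F.drop p.t0).take p.count
  let tS := C.tmsS R.S t₁ t₂
  let tP := C.tmsP R.S t₁ t₂
  let tM := C.tmsM R.S t₁ t₂
  subset3 (famTriple R.S (R.rows 0 0) (R.rows 0 1) (R.rows 0 2) tS C sl) p.P3 &&
    subset3 (famTriple R.S (R.rows 1 0) (R.rows 1 1) (R.rows 1 2) tP C sl) p.P4 &&
    subset3 (famTriple R.S (R.rows 2 0) (R.rows 2 1) (R.rows 2 2) tP C sl) p.P5 &&
    subsetI (headPolyTM R.S (R.rows 3 0) tM C.nF C.ℓ C.ctr sl) p.P0 &&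
    subset3 (famTriple R.S (R.rows 4 0) (R.rows 4 1) (R.rows 4 2) tP C sl) p.Pt

/-- Summed claims of a view as a triple. [folklore] -/
def sumV (f : HeadPartOdd → HeadPart) (ps : List HeadPartOdd) : ITriple :=
  (sumPX (ps.map f), sumPY (ps.map f), sumPZ (ps.map f))

/-! ### The affine sign test -/

/-- Core test on a sub-interval `[lo, hi]` of the local cell: lower bound of
`V₄ − V₅ + c₃ V₃ + c₀ V₀ + c_t V_t` (scaled by `S²`) from the family enclosures and the scalar intervals. [folklore] -/
def oddCore (S : ℕ) (T3 T4 T5 : ITriple) (P0 : IPoly) (Tt : ITriple) (Wb Wσ Wt : ℚ) (C3 C0 Ct : MI)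
    (lo hi : ℚ) : Bool :=
  decide (0 < lowB3 S T4 lo hi Wσ * (S : ℚ) - hiB3 S T5 lo hi Wσ * (S : ℚ) +
    mulLo C3 (lowB3 S T3 lo hi Wb) (hiB3 S T3 lo hi Wb) +
    mulLo C0 (lowB S P0 lo hi : ℚ) (hiB S P0 lo hi : ℚ) +
    mulLo Ct (lowB3 S Tt lo hi Wt) (hiB3 S Tt lo hi Wt))

/-- Bisection of the affine sign test to depth `d`. [folklore] -/
def posOnOdd (S : ℕ) (T3 T4 T5 : ITriple) (P0 : IPoly) (Tt : ITriple) (Wb Wσ Wt : ℚ) (C3 C0 Ct : MI) :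
    ℕ → ℚ → ℚ → Bool
  | 0, a, b => oddCore S T3 T4 T5 P0 Tt Wb Wσ Wt C3 C0 Ct a b
  | d + 1, a, b =>
      oddCore S T3 T4 T5 P0 Tt Wb Wσ Wt C3 C0 Ct a b ||
        (posOnOdd S T3 T4 T5 P0 Tt Wb Wσ Wt C3 C0 Ct d a ((a + b) / 2) &&
          posOnOdd S T3 T4 T5 P0 Tt Wb Wσ Wt C3 C0 Ct d ((a + b) / 2) b)

/-- `v₄ − v₅ + c₃v₃ + c₀v₀ + c_t v_t > 0` from five enclosures and three scalar intervals. [folklore] -/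
theorem affine5_pos {S : ℕ} (hS : 0 < S) {v4 v5 v3 v0 vt c3 c0 ct : ℝ} {L4 H5 L3 H3 L0 H0 Lt Ht : ℚ}
    {C3 C0 Ct : MI} (h4 : (L4 : ℝ) ≤ v4 * S) (h5 : v5 * S ≤ H5) (h3L : (L3 : ℝ) ≤ v3 * S) (h3H : v3 * S ≤ H3)
    (h0L : (L0 : ℝ) ≤ v0 * S) (h0H : v0 * S ≤ H0) (htL : (Lt : ℝ) ≤ vt * S) (htH : vt * S ≤ Ht)
    (hc3 : MI.mem S c3 C3) (hc0 : MI.mem S c0 C0) (hct : MI.mem S ct Ct)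
    (hpos : 0 < L4 * (S : ℚ) - H5 * (S : ℚ) + mulLo C3 L3 H3 + mulLo C0 L0 H0 + mulLo Ct Lt Ht) :
    0 < v4 - v5 + c3 * v3 + c0 * v0 + ct * vt := by
  have hm3 := mulLo_le hc3 h3L h3H
  have hm0 := mulLo_le hc0 h0L h0H
  have hmt := mulLo_le hct htL htH
  have hSr : (0 : ℝ) < S := by exact_mod_cast hS
  have hposR : (0 : ℝ) < (L4 : ℝ) * S - (H5 : ℝ) * S + (mulLo C3 L3 H3 : ℚ) + (mulLo C0 L0 H0 : ℚ) +
      (mulLo Ct Lt Ht : ℚ) := by exact_mod_cast hpos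
  have h4S : (L4 : ℝ) * S ≤ v4 * S * S := mul_le_mul_of_nonneg_right h4 hSr.le
  have h5S : v5 * S * S ≤ (H5 : ℝ) * S := mul_le_mul_of_nonneg_right h5 hSr.le
  have hsum : 0 < (v4 - v5 + c3 * v3 + c0 * v0 + ct * vt) * ((S : ℝ) * S) := by nlinarith
  have hSS : (0 : ℝ) < (S : ℝ) * S := by positivity
  nlinarith [hsum, hSS]

/-- **Soundness of the core test.** [folklore] -/
theorem oddCore_sound {S : ℕ} (hS : 0 < S) {T3 T4 T5 Tt : ITriple} {P0 : IPoly} {Wb Wσ Wt : ℚ} (hWb : 0 ≤ Wb)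
    (hWσ : 0 ≤ Wσ) (hWt : 0 ≤ Wt) {C3 C0 Ct : MI} {lo hi : ℚ}
    (h : oddCore S T3 T4 T5 P0 Tt Wb Wσ Wt C3 C0 Ct lo hi = true)
    {r3 r4 r5 rt : List ℝ × List ℝ × List ℝ} {r0 : List ℝ} (m3 : PMem3 S r3 T3) (m4 : PMem3 S r4 T4)
    (m5 : PMem3 S r5 T5) (m0 : PMem S r0 P0) (mt : PMem3 S rt Tt) {c3 c0 ct : ℝ} (hc3 : MI.mem S c3 C3)
    (hc0 : MI.mem S c0 C0) (hct : MI.mem S ct Ct) {x : ℝ} (hlo : (lo : ℝ) ≤ x) (hhi : x ≤ hi) {δb δσ δt : ℝ}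
    (hδb : |δb| ≤ Wb) (hδσ : |δσ| ≤ Wσ) (hδt : |δt| ≤ Wt) :
    0 < val3 r4 x δσ - val3 r5 x δσ + c3 * val3 r3 x δb + c0 * evalR r0 x + ct * val3 rt x δt := by
  simp only [oddCore, decide_eq_true_eq] at h
  exact affine5_pos hS (lowB3_le' hS hWσ m4 hlo hhi hδσ) (le_hiB3 hS hWσ m5 hlo hhi hδσ)
    (lowB3_le' hS hWb m3 hlo hhi hδb) (le_hiB3 hS hWb m3 hlo hhi hδb)
    (by exact_mod_cast lowB_le hS m0 hlo hhi) (by exact_mod_cast le_hiB hS m0 hlo hhi)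
    (lowB3_le' hS hWt mt hlo hhi hδt) (le_hiB3 hS hWt mt hlo hhi hδt) hc3 hc0 hct h

/-- **Soundness of the bisected test.** [folklore] -/
theorem posOnOdd_sound {S : ℕ} (hS : 0 < S) {T3 T4 T5 Tt : ITriple} {P0 : IPoly} {Wb Wσ Wt : ℚ} (hWb : 0 ≤ Wb)
    (hWσ : 0 ≤ Wσ) (hWt : 0 ≤ Wt) {C3 C0 Ct : MI}
    {r3 r4 r5 rt : List ℝ × List ℝ × List ℝ} {r0 : List ℝ} (m3 : PMem3 S r3 T3) (m4 : PMem3 S r4 T4)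
    (m5 : PMem3 S r5 T5) (m0 : PMem S r0 P0) (mt : PMem3 S rt Tt) {c3 c0 ct : ℝ} (hc3 : MI.mem S c3 C3)
    (hc0 : MI.mem S c0 C0) (hct : MI.mem S ct Ct) {δb δσ δt : ℝ}
    (hδb : |δb| ≤ Wb) (hδσ : |δσ| ≤ Wσ) (hδt : |δt| ≤ Wt) :
    ∀ {d : ℕ} {lo hi : ℚ}, posOnOdd S T3 T4 T5 P0 Tt Wb Wσ Wt C3 C0 Ct d lo hi = true →
      ∀ {x : ℝ}, (lo : ℝ) ≤ x → x ≤ hi →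
        0 < val3 r4 x δσ - val3 r5 x δσ + c3 * val3 r3 x δb + c0 * evalR r0 x + ct * val3 rt x δt
  | 0, _, _, h, _, hlo, hhi => oddCore_sound hS hWb hWσ hWt h m3 m4 m5 m0 mt hc3 hc0 hct hlo hhi hδb hδσ hδt
  | d + 1, a, b, h, x, hlo, hhi => by
      simp only [posOnOdd, Bool.or_eq_true, Bool.and_eq_true] at h
      rcases h with h | ⟨ha, hb⟩
      · exact oddCore_sound hS hWb hWσ hWt h m3 m4 m5 m0 mt hc3 hc0 hct hlo hhi hδb hδσ hδt
      · have hmR : (((a + b) / 2 : ℚ) : ℝ) = ((a : ℝ) + b) / 2 := by push_cast; ring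
        rcases le_or_gt x (((a : ℝ) + b) / 2) with hx | hx
        · exact posOnOdd_sound hS hWb hWσ hWt m3 m4 m5 m0 mt hc3 hc0 hct hδb hδσ hδt ha hlo (by rw [hmR]; exact hx)
        · exact posOnOdd_sound hS hWb hWσ hWt m3 m4 m5 m0 mt hc3 hc0 hct hδb hδσ hδt hb (by rw [hmR]; exact hx.le) hhi

/-! ### The final Boolean of a cell -/

/-- **Final check, odd head** (one declaration): side conditions (scale, TM degree ≥ 2, pivots, `t₁ ≤ t₂`, `0 < κ₀`, head
indices within the rows), the tiling of the parts, and the bisected affine sign test on the SUMMED claims with the scalars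
`c₃ = (−1)^ℓ·K`, `c₀ = Mσ/(2κ₀)`, `c_t = −Mε/(2κ₀)` (`K ∋ (½)^{Δε−Δσ}`, `Mσ ∋ (½)^{−2Δσ}`, `Mε ∋ (½)^{−2Δε}` interval data).
[folklore] -/
def oddHeadFinalOKΔ (R : OddHeadRowsΔ) (dP : ℕ) (C : EvenCellTM) (t₁ t₂ : ℚ) (K Mσ Mε : MI) (κ₀ : ℚ)
    (ps : List HeadPartOdd) : Bool :=
  decide (2 ≤ C.D) && pivOK C.ctr C.ℓ C.e C.nF && decide (t₁ ≤ t₂) && decide (0 < κ₀) &&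
    (C.F.all fun q => decide (q.2 < R.J)) && tilesOK 0 (ps.map HeadPartOdd.v3) C.F.length &&
    posOnOdd R.S (sumV HeadPartOdd.v3 ps) (sumV HeadPartOdd.v4 ps) (sumV HeadPartOdd.v5 ps)
      (sumPX (ps.map HeadPartOdd.v0)) (sumV HeadPartOdd.vt ps) R.Wb R.Wσ R.Wt
      (smulRatMI K ((-1) ^ C.ℓ)) (smulRatMI Mσ (κ₀⁻¹ / 2)) (smulRatMI Mε (-(κ₀⁻¹ / 2))) dP (-C.hw) C.hw

/-! ### Tiling of the views -/

/-- All views tile alike (they share `t0`, `count`). [folklore] -/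
theorem tilesOK_view (f : HeadPartOdd → HeadPart) (hf : ∀ p, (f p).t0 = p.t0 ∧ (f p).count = p.count) :
    ∀ (ps : List HeadPartOdd) (pos n : ℕ), tilesOK pos (ps.map f) n = tilesOK pos (ps.map HeadPartOdd.v3) n
  | [], _, _ => rfl
  | p :: ps, pos, n => by
      obtain ⟨h1, h2⟩ := hf p
      simp only [List.map_cons, tilesOK, h1, h2, HeadPartOdd.v3, tilesOK_view f hf ps]

/-- [folklore] -/
theorem tilesOK_v4 (ps : List HeadPartOdd) (pos n : ℕ) :
    tilesOK pos (ps.map HeadPartOdd.v4) n = tilesOK pos (ps.map HeadPartOdd.v3) n :=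
  tilesOK_view _ (fun _ => ⟨rfl, rfl⟩) ps pos n
/-- [folklore] -/
theorem tilesOK_v5 (ps : List HeadPartOdd) (pos n : ℕ) :
    tilesOK pos (ps.map HeadPartOdd.v5) n = tilesOK pos (ps.map HeadPartOdd.v3) n :=
  tilesOK_view _ (fun _ => ⟨rfl, rfl⟩) ps pos n
/-- [folklore] -/
theorem tilesOK_vt (ps : List HeadPartOdd) (pos n : ℕ) :
    tilesOK pos (ps.map HeadPartOdd.vt) n = tilesOK pos (ps.map HeadPartOdd.v3) n :=
  tilesOK_view _ (fun _ => ⟨rfl, rfl⟩) ps pos n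
/-- [folklore] -/
theorem tilesOK_v0 (ps : List HeadPartOdd) (pos n : ℕ) :
    tilesOK pos (ps.map HeadPartOdd.v0) n = tilesOK pos (ps.map HeadPartOdd.v3) n :=
  tilesOK_view _ (fun _ => ⟨rfl, rfl⟩) ps pos n

/-! ### Generic head sums -/

/-- A head sum with an arbitrary coefficient function:
`Σ_{(n,j)∈F} coef(n,j)/λ_ℓ · (½)^n · q̂(s; Δ + n, j)`. [folklore] -/
noncomputable def headSumR (coef : ℕ × ℕ → ℝ) (w : ℕ × ℕ → ℝ) (Sx : Finset (ℕ × ℕ)) (ℓ : ℕ)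
    (F : List (ℕ × ℕ)) (s Δ σ : ℝ) : ℝ :=
  (F.map fun q => coef q / legendreLam ℓ * ((1 / 2 : ℝ) ^ q.1 * qSum w Sx s σ (Δ + (q.1 : ℝ)) q.2)).sum

/-- The generic head sum at `Δ = ctr + ρ` as the value of the real head polynomial on GIVEN rows and coefficient lists.
[folklore] -/
theorem headSumR_eq_evalR {coef : ℕ × ℕ → ℝ} {w : ℕ × ℕ → ℝ} {Sx : Finset (ℕ × ℕ)} {s σ : ℝ} (ℓ : ℕ) (ctr : ℚ)
    (F : List (ℕ × ℕ)) (ρ : ℝ) {row : ℕ → List ℝ} (hrow : ∀ q ∈ F, ∀ E : ℝ, qSum w Sx s σ E q.2 = evalR (row q.2) E)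
    {asq : ℕ × ℕ → List ℝ} (hasq : ∀ q ∈ F, coef q = evalR (asq q) ρ) :
    headSumR coef w Sx ℓ F s ((ctr : ℝ) + ρ) σ = evalR (headPolyTMR row asq ℓ ctr F) ρ := by
  rw [evalR_headPolyTMR, headSumR]
  congr 1
  refine List.map_congr_left fun q hq => ?_
  rw [← hrow q hq, ← hasq q hq, show (q.1 : ℝ) + (ctr : ℝ) + ρ = (ctr : ℝ) + ρ + (q.1 : ℝ) by ring]
  have hlam : ((PointKernel.legendreLamQ ℓ : ℚ) : ℝ) = legendreLam ℓ := PointKernel.cast_legendreLamQ ℓ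
  push_cast
  rw [hlam]
  have hl0 : legendreLam ℓ ≠ 0 := (legendreLam_pos ℓ).ne'
  have h2 : (2 : ℝ) ^ q.1 ≠ 0 := pow_ne_zero _ two_ne_zero
  rw [one_div_pow]
  field_simp

/-- The regularised bracket: `oddConeHeadBracket` with the three coefficient values replaced by `regAB`.
[cite: KosPolandSimmonsduffin2014, §3.3 eq. (3.16)] -/
noncomputable def oddBracketReg (S : Finset (ℕ × ℕ)) (w : Fin 5 → ℕ × ℕ → ℝ) (Sψ : Finset (ℕ × ℕ)) (ψ : ℕ × ℕ → ℝ)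
    (κ₀ Δσ Δε Δ : ℝ) (ℓ : ℕ) (q : ℕ × ℕ) : ℝ :=
  (-1 : ℝ) ^ ℓ * (regAB (-(Δσ - Δε) / 2) ((Δσ - Δε) / 2) Δ ℓ q.1 q.2 / legendreLam ℓ) *
        ((1 / 2 : ℝ) ^ (Δε - Δσ) * qSum (w 2) S ((Δσ + Δε) / 2) (-1) (Δ + (q.1 : ℝ)) q.2) +
      regAB ((Δσ - Δε) / 2) ((Δσ - Δε) / 2) Δ ℓ q.1 q.2 / legendreLam ℓ *
        (qSum (w 3) S Δσ (-1) (Δ + (q.1 : ℝ)) q.2 - qSum (w 4) S Δσ 1 (Δ + (q.1 : ℝ)) q.2) +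
    κ₀⁻¹ / 2 *
      (regAB (-(Δσ - Δε) / 2) (-(Δσ - Δε) / 2) Δ ℓ q.1 q.2 / legendreLam ℓ *
          ((1 / 2 : ℝ) ^ (-(2 * Δσ)) * qSum ψ Sψ 0 0 (Δ + (q.1 : ℝ)) q.2) -
        regAB ((Δσ - Δε) / 2) ((Δσ - Δε) / 2) Δ ℓ q.1 q.2 / legendreLam ℓ *
          ((1 / 2 : ℝ) ^ (-(2 * Δε)) * qSum ψ Sψ (Δσ - Δε) 0 (Δ + (q.1 : ℝ)) q.2))

/-- `B_reg = (Δ − b_ℓ)·B` above the unitarity bound. [cite: DolanOsborn2004, §3 eq. (3.12)] -/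
theorem oddBracketReg_eq (S : Finset (ℕ × ℕ)) (w : Fin 5 → ℕ × ℕ → ℝ) (Sψ : Finset (ℕ × ℕ)) (ψ : ℕ × ℕ → ℝ)
    (κ₀ Δσ Δε : ℝ) {Δ : ℝ} {ℓ : ℕ} (hΔ : unitarityBound3D ℓ < Δ) (q : ℕ × ℕ) :
    oddBracketReg S w Sψ ψ κ₀ Δσ Δε Δ ℓ q = (Δ - unitarityBound3D ℓ) * oddConeHeadBracket S w Sψ ψ κ₀ Δσ Δε Δ ℓ q := by
  simp only [oddBracketReg, oddConeHeadBracket, regAB_eq _ _ hΔ]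
  ring

/-- **Decomposition of the regularised bracket sum into the five family head sums.** [folklore] -/
theorem sum_oddBracketReg (S : Finset (ℕ × ℕ)) (w : Fin 5 → ℕ × ℕ → ℝ) (Sψ : Finset (ℕ × ℕ)) (ψ : ℕ × ℕ → ℝ)
    (κ₀ Δσ Δε Δ : ℝ) (ℓ : ℕ) : ∀ F : List (ℕ × ℕ),
    (F.map fun q => (1 / 2 : ℝ) ^ q.1 * oddBracketReg S w Sψ ψ κ₀ Δσ Δε Δ ℓ q).sum =
      (-1 : ℝ) ^ ℓ * (1 / 2 : ℝ) ^ (Δε - Δσ) *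
          headSumR (fun q => regAB (-(Δσ - Δε) / 2) ((Δσ - Δε) / 2) Δ ℓ q.1 q.2) (w 2) S ℓ F ((Δσ + Δε) / 2) Δ (-1) +
        headSumR (fun q => regAB ((Δσ - Δε) / 2) ((Δσ - Δε) / 2) Δ ℓ q.1 q.2) (w 3) S ℓ F Δσ Δ (-1) -
        headSumR (fun q => regAB ((Δσ - Δε) / 2) ((Δσ - Δε) / 2) Δ ℓ q.1 q.2) (w 4) S ℓ F Δσ Δ 1 +
        κ₀⁻¹ / 2 * (1 / 2 : ℝ) ^ (-(2 * Δσ)) *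
          headSumR (fun q => regAB (-(Δσ - Δε) / 2) (-(Δσ - Δε) / 2) Δ ℓ q.1 q.2) ψ Sψ ℓ F 0 Δ 0 +
        -(κ₀⁻¹ / 2 * (1 / 2 : ℝ) ^ (-(2 * Δε))) *
          headSumR (fun q => regAB ((Δσ - Δε) / 2) ((Δσ - Δε) / 2) Δ ℓ q.1 q.2) ψ Sψ ℓ F (Δσ - Δε) Δ 0
  | [] => by simp [headSumR]
  | q :: qs => by
      have ih := sum_oddBracketReg S w Sψ ψ κ₀ Δσ Δε Δ ℓ qs
      simp only [List.map_cons, List.sum_cons, headSumR] at ih ⊢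
      rw [ih, oddBracketReg]
      ring

end Summit.CriticalPhenomena.Ising3D
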